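import Literature.LinearAlgebra.Matrix.BorderedAdjugate
import Literature.MathematicalPhysics.QuantumFieldTheory.AoyamaKinoshitaNio2019.ParametricBuildingBlocks
import HarnessLib

/-!
# The UV limit of the parametric building blocks `U` and `B_ij` under the scaling of a subdiagram (AHKN 2006 §3.1 eq. for `U`, `B_ij`; §3.3 `[U]^S_UV = U_S U_{G/S}`, `[B_ij]^S_UV = B^S_ij U_{G/S}` / `B^{G/S}_ij U_S`) — PROVED in the loop-matrix form `U = det U_st`, `B = U Σ ξ ξ U⁻¹` for an `S`-adapted fundamental set of circuits

independent recomputation; certified where stated, statistical where stated; no new-physics claim.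

HONEST FRAMING (venture `QEDPrecision`, cell `qed-hepp`, seat `qed-hepp-lit` gen 2; VALUE-FREE: polynomial identities in the entries of an arbitrary
integer matrix and arbitrary parameters in a commutative ring — no graph, no integral, nothing of any Set-V family). Lead's ask L4 («AHKN's K_S UV-limit
rules as printed … as THEOREMS»). The `U`-rule in spanning-tree language is already PROVED in the tree (`KirchhoffFactorization`, Brown 2017 Prop. 2.2);
this file proves the rules in the language the cell's generator and AHKN's automation actually use — the LOOP-MATRIX recipe typed in
`AoyamaKinoshitaNio2019.ParametricBuildingBlocks` (`Umat`, `Ufun`, `Bfun`) — and adds the `B_ij` rules, which the tree did not have in any form.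

SOURCE, AS PRINTED. [AoyamaEtAl2006] T. Aoyama, M. Hayakawa, T. Kinoshita, M. Nio, Nucl. Phys. B 740 (2006) 138 = arXiv:hep-ph/0512288 (`lit read
paper:arxiv-hep-ph_0512288`, e-print numbering, chunks pNNNN:Lk). §2.3 (p0007:L140–L160): «Suppose a set of independent self-nonintersecting loops
(called a fundamental set of circuits) is given and define U_st by the summation over all chains by U_st = Σ_α z_α ξ_{α,s} ξ_{α,t}, where s, t are
labels of circuits in the set. Then, U and B_{αβ} are given by U = det_{st} U_{st}, B_{αβ} = U Σ_{st} ξ_{α,s} ξ_{β,t} (U⁻¹)_{st}.» §3.1 (p0010:L100–L170):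
«z_i = O(ε) (i ∈ S), O(1) (otherwise), with ε → 0. To find how a UV divergence arises from a subdiagram S consisting of N_S internal lines and n_S loops
… In the limit ε → 0, the homogeneous polynomials in the integrand behave as follows. (See Section 3.3 for proofs.) U = O(ε^{n_S}), V = O(1), and
B_ij = O(ε^{n_S−1}) if i, j ∈ S, O(ε^{n_S}) otherwise. … Let us denote the UV limit of U and B_ij as [U]^S_UV and [B_ij]^S_UV.» §3.3 (p0011:L39–L167,
p0012:L1–L57): «It is found that each of them factorizes into two parts, one of which depends solely on the subdiagram S, and the other on the residual
diagram G/S alone. … [U]^S_UV = U_S U_{G/S} (= O(ε^{n_S}))», and, after the three cases «c is contained in S», «c runs outside of S», «c is contained in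
both S and G − S», «[B_ij]^S_UV = B^S_ij U_{G/S}» for «i, j ∈ S» and «[B_ij]^S_UV = B^{G/S}_ij U_S, i, j ∈ (G/S)» (the mixed case m ∈ S, j ∉ S carries
the scalar current A^S_m and is O(ε^{n_S}); only its ORDER is typed here).

TYPING (the dictionary, stated once). Circuits of the fundamental set are split into INNER ones `κI` (those «contained in S») and OUTER ones `κO`;
lines into those of `S`, `μS`, and the others, `μO`. «S-adapted» means the inner circuits use no line outside `S`: the loop matrix is
`adaptedT TI TOS TOO = fromBlocks TI 0 TOS TOO` (rows `κI ⊕ κO`, columns `μS ⊕ μO`; integer entries «(1, −1, 0)»). Such a fundamental set exists for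
every connected `S` — extend a spanning tree of `S` to one of `G`: the chords inside `S` give `n_S = |κI|` circuits inside `S`, and the outer circuits
with the lines of `S` deleted, `TOO`, form a fundamental set of `G/S` — so that `UDet TI zS = U_S`, `UDet TOO zO = U_{G/S}`, `BAdj TI zS = B^S`,
`BAdj TOO zO = B^{G/S}`; this graph-theoretic dictionary is NOT formalized here (it is AHKN's §3.3 case analysis «c ⊆ S / c outside S / c meets
both»), everything below is an identity for ARBITRARY blocks `TI, TOS, TOO` and parameters `zS, zO` in any commutative ring. The scaling «z_i = O(ε),
i ∈ S» is `scaledZ zS zO ε = (ε·zS, zO)`. `UMat/UDet/BAdj` are `Umat/Ufun/Bfun` of `ParametricBuildingBlocks` with arbitrary finite index types and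
coefficients (`Umat_eq_UMat`, `Ufun_eq_UDet`, `Bfun_eq_BAdj`: `rfl`).
PROVED (0 named facts). `UMat_adapted` (the scaled `U_st` in block form), `UDet_adapted`: **`U(ε) = ε^{n_S} · det M(ε)`** with the explicit cofactor
matrix `cofMat … ε` and **`det_cofMat_zero`: `det M(0) = U_S · U_{G/S}`** — i.e. «U = O(ε^{n_S})» with leading term «[U]^S_UV = U_S U_{G/S}»;
`adjugate_UMat_adapted` (adjugate of the scaled `U_st` = `adj M(ε) · diag(ε^{n_S−1} 1, ε^{n_S} 1)`), whence **`BAdj_adapted_inr`: `B_{a j}(ε) = ε^{n_S} ·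
cofBO(ε)` for every line `j ∉ S`** («O(ε^{n_S}) otherwise», by symmetry `BAdj_symm` also for `a ∉ S`) with **`cofBO_zero`: leading term `U_S · B^{G/S}_{ij}`
for `i, j ∉ S`**, and **`BAdj_adapted_inl`: `B_{a j}(ε) = ε^{n_S−1} · cofBS(ε)` for `j ∈ S`** (needs `n_S ≥ 1`) with **`cofBS_zero`: leading term
`U_{G/S} · B^S_{ij}` for `i, j ∈ S`** («O(ε^{n_S−1}) if i, j ∈ S», «[B_ij]^S_UV = B^S_ij U_{G/S}»). Tools: the adjugate blocks of a block-triangular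
matrix (`adjugate_fromBlocks_zero₂₁_inl_inl / _inr_inl / _inr_inr`, cofactor expansion via `Matrix.adjugate_apply` + `det_fromBlocks_zero₂₁`).
NOT CLAIMED: the rules for `A_j`, `C_ij`, `V` (AHKN §3.3, second half) and the leading COEFFICIENT of the mixed `B_{mj}` (which carries the scalar
current `A^S_m`); the existence of an adapted fundamental set (dictionary above).
-/

namespace Literature.MathematicalPhysics.QuantumFieldTheory.AoyamaEtAl2006

open Matrix Finset

/-! ## The loop-matrix building blocks over a commutative ring -/

section General

variable {R : Type*} [CommRing R] {κ μ : Type*} [Fintype κ] [Fintype μ] [DecidableEq κ] [DecidableEq μ]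

/-- `U_st = Σ_α z_α ξ_{α,s} ξ_{α,t}` for a loop matrix `T` (rows = circuits `s`, columns = lines `α`) and line parameters `z`.
[cite: AoyamaEtAl2006, §2.3 (eq. for U_st)] -/
def UMat (T : Matrix κ μ ℤ) (z : μ → R) : Matrix κ κ R := fun s t => ∑ b, (T s b : R) * (T t b : R) * z b

/-- `U = det_{st} U_{st}`. [cite: AoyamaEtAl2006, §2.3] -/
def UDet (T : Matrix κ μ ℤ) (z : μ → R) : R := (UMat T z).det

/-- `B_{αβ} = U Σ_{st} ξ_{α,s} ξ_{β,t} (U⁻¹)_{st}`, typed with `U · U⁻¹ = adj(U_st)` (a polynomial). [cite: AoyamaEtAl2006, §2.3] -/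
def BAdj (T : Matrix κ μ ℤ) (z : μ → R) (a b : μ) : R := ∑ s, ∑ t, (UMat T z).adjugate s t * (T s a : R) * (T t b : R)

omit [Fintype κ] [DecidableEq κ] in
/-- `U_st` as a matrix product `T · diag(z) · Tᵀ`. [cite: AoyamaEtAl2006, §2.3] -/
theorem UMat_eq_mul (T : Matrix κ μ ℤ) (z : μ → R) :
    UMat T z = T.map (Int.cast : ℤ → R) * Matrix.diagonal z * (T.map (Int.cast : ℤ → R))ᵀ := by
  ext s t
  rw [Matrix.mul_apply]
  simp only [UMat, Matrix.mul_diagonal, Matrix.transpose_apply, Matrix.map_apply]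
  exact Finset.sum_congr rfl fun b _ => by ring

omit [Fintype κ] [DecidableEq κ] [DecidableEq μ] in
/-- `U_st` is symmetric. [cite: AoyamaEtAl2006, §2.3] -/
theorem UMat_transpose (T : Matrix κ μ ℤ) (z : μ → R) : (UMat T z)ᵀ = UMat T z := by
  ext s t
  simp only [UMat, Matrix.transpose_apply]
  exact Finset.sum_congr rfl fun b _ => by ring

omit [DecidableEq μ] in
/-- `B_{αβ}` as the matrix entry `(Tᵀ · adj(U_st) · T)_{αβ}`. [cite: AoyamaEtAl2006, §2.3] -/
theorem BAdj_eq_mul_apply (T : Matrix κ μ ℤ) (z : μ → R) (a b : μ) :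
    BAdj T z a b = ((T.map (Int.cast : ℤ → R))ᵀ * (UMat T z).adjugate * T.map (Int.cast : ℤ → R)) a b := by
  simp only [BAdj, Matrix.mul_apply, Matrix.transpose_apply, Matrix.map_apply, Finset.sum_mul]
  rw [Finset.sum_comm]
  exact Finset.sum_congr rfl fun t _ => Finset.sum_congr rfl fun s _ => by ring

omit [DecidableEq μ] in
/-- `B_{αβ} = B_{βα}`. [cite: AoyamaEtAl2006, §2.3] -/
theorem BAdj_symm (T : Matrix κ μ ℤ) (z : μ → R) (a b : μ) : BAdj T z a b = BAdj T z b a := by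
  have h : ((UMat T z).adjugate)ᵀ = (UMat T z).adjugate := by rw [adjugate_transpose, UMat_transpose]
  simp only [BAdj]
  rw [Finset.sum_comm]
  refine Finset.sum_congr rfl fun s _ => Finset.sum_congr rfl fun t _ => ?_
  rw [show (UMat T z).adjugate t s = (UMat T z).adjugate s t from by rw [← Matrix.transpose_apply (UMat T z).adjugate s t, h]]
  ring

/-- The typed fourth-order recipe `Umat` of `ParametricBuildingBlocks` is `UMat` (rational parameters, `Fin` indices). [cite: AoyamaKinoshitaNio2019, §4.3 eq. (52)] -/
theorem Umat_eq_UMat {n m : ℕ} (T : Matrix (Fin n) (Fin m) ℤ) (l : Fin m → ℚ) : AoyamaKinoshitaNio2019.Umat T l = UMat T l := rfl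

/-- `Ufun = UDet`. [cite: AoyamaKinoshitaNio2019, §4.3 eq. (53)] -/
theorem Ufun_eq_UDet {n m : ℕ} (T : Matrix (Fin n) (Fin m) ℤ) (l : Fin m → ℚ) : AoyamaKinoshitaNio2019.Ufun T l = UDet T l := rfl

/-- `Bfun = BAdj`. [cite: AoyamaKinoshitaNio2019, §4.3 eq. (54)] -/
theorem Bfun_eq_BAdj {n m : ℕ} (T : Matrix (Fin n) (Fin m) ℤ) (l : Fin m → ℚ) (a b : Fin m) :
    AoyamaKinoshitaNio2019.Bfun T l a b = BAdj T l a b := rfl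

end General

/-! ## Adjugate blocks of a block upper-triangular matrix (cofactor expansion) -/

section AdjugateBlocks

variable {R : Type*} [CommRing R] {m n : Type*} [Fintype m] [Fintype n] [DecidableEq m] [DecidableEq n]

omit [CommRing R] [Fintype m] [Fintype n] in
/-- Updating a lower row of a block matrix updates the two lower blocks. [folklore] -/
private theorem fromBlocks_updateRow_inr (A : Matrix m m R) (B : Matrix m n R) (C : Matrix n m R) (D : Matrix n n R) (k : n)
    (v : m ⊕ n → R) :
    (fromBlocks A B C D).updateRow (Sum.inr k) v = fromBlocks A B (C.updateRow k (v ∘ Sum.inl)) (D.updateRow k (v ∘ Sum.inr)) := by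
  ext (i | i) (j | j)
  · simp [updateRow_apply]
  · simp [updateRow_apply]
  · by_cases h : i = k
    · subst h; simp [updateRow_apply]
    · simp [updateRow_apply, h]
  · by_cases h : i = k
    · subst h; simp [updateRow_apply]
    · simp [updateRow_apply, h]

/-- Upper-left adjugate block of `[[A, B], [0, D]]`: `adj (inl i) (inl k) = det D · adj(A) i k`. [folklore] -/
private theorem adjugate_fromBlocks_zero₂₁_inl_inl (A : Matrix m m R) (B : Matrix m n R) (D : Matrix n n R) (i k : m) :
    (fromBlocks A B 0 D).adjugate (Sum.inl i) (Sum.inl k) = D.det * A.adjugate i k := by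
  have h1 : (Pi.single (Sum.inl i : m ⊕ n) (1 : R) ∘ Sum.inl) = Pi.single i 1 := by
    funext j
    simp [Pi.single_apply]
  rw [adjugate_apply, Literature.LinearAlgebra.Matrix.fromBlocks_updateRow_inl, det_fromBlocks_zero₂₁, adjugate_apply, mul_comm, h1]

/-- Lower-left adjugate block of `[[A, B], [0, D]]` vanishes. [folklore] -/
private theorem adjugate_fromBlocks_zero₂₁_inr_inl (A : Matrix m m R) (B : Matrix m n R) (D : Matrix n n R) (i : n) (k : m) :
    (fromBlocks A B 0 D).adjugate (Sum.inr i) (Sum.inl k) = 0 := by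
  rw [adjugate_apply, Literature.LinearAlgebra.Matrix.fromBlocks_updateRow_inl, det_fromBlocks_zero₂₁]
  have h0 : (A.updateRow k (Pi.single (Sum.inr i : m ⊕ n) (1 : R) ∘ Sum.inl)).det = 0 :=
    det_eq_zero_of_row_eq_zero k fun j => by simp [updateRow_apply]
  rw [h0, zero_mul]

/-- Lower-right adjugate block of `[[A, B], [0, D]]`: `adj (inr i) (inr k) = det A · adj(D) i k`. [folklore] -/
private theorem adjugate_fromBlocks_zero₂₁_inr_inr (A : Matrix m m R) (B : Matrix m n R) (D : Matrix n n R) (i k : n) :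
    (fromBlocks A B 0 D).adjugate (Sum.inr i) (Sum.inr k) = A.det * D.adjugate i k := by
  rw [adjugate_apply, fromBlocks_updateRow_inr, adjugate_apply]
  have hC : (0 : Matrix n m R).updateRow k (Pi.single (Sum.inr i : m ⊕ n) (1 : R) ∘ Sum.inl) = 0 := by
    ext r j
    simp [updateRow_apply]
  have hD : (Pi.single (Sum.inr i : m ⊕ n) (1 : R) ∘ Sum.inr) = Pi.single i 1 := by
    funext j
    simp [Pi.single_apply]
  rw [hC, hD, det_fromBlocks_zero₂₁]

end AdjugateBlocks

/-! ## The `S`-adapted loop matrix and the scaling `z_i = O(ε)`, `i ∈ S` -/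

section Adapted

variable {R : Type*} [CommRing R]
variable {κI κO μS μO : Type*} [Fintype κI] [Fintype κO] [Fintype μS] [Fintype μO]
  [DecidableEq κI] [DecidableEq κO]
variable (TI : Matrix κI μS ℤ) (TOS : Matrix κO μS ℤ) (TOO : Matrix κO μO ℤ) (zS : μS → R) (zO : μO → R)

/-- An `S`-ADAPTED fundamental set of circuits: the inner circuits `κI` («c is contained in S») use only lines of `S` (block `0` on the outer
lines), the outer circuits `κO` are arbitrary («c runs outside of S» or «c is contained in both S and G − S»). [cite: AoyamaEtAl2006, §3.3] -/
def adaptedT : Matrix (κI ⊕ κO) (μS ⊕ μO) ℤ := fromBlocks TI 0 TOS TOO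

/-- The UV scaling of the parameters: «z_i = O(ε), i ∈ S; O(1) otherwise». [cite: AoyamaEtAl2006, §3.1 (eq. uv:uvlimit)] -/
def scaledZ (ε : R) : μS ⊕ μO → R := Sum.elim (fun b => ε * zS b) zO

/-- The cross block `Σ_{b∈S} ξ_{b,s} ξ_{b,t} z_b` between an inner circuit `s` and an outer circuit `t`. [cite: AoyamaEtAl2006, §3.3] -/
def crossMat : Matrix κI κO R := fun s t => ∑ b, (TI s b : R) * (TOS t b : R) * zS b

/-- The cofactor matrix `M(ε)` with `U_st(ε) = diag(ε·1, 1) · M(ε)`. [cite: AoyamaEtAl2006, §3.3] -/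
def cofMat (ε : R) : Matrix (κI ⊕ κO) (κI ⊕ κO) R :=
  fromBlocks (UMat TI zS) (crossMat TI TOS zS) (ε • (crossMat TI TOS zS)ᵀ) (UMat TOO zO + ε • UMat TOS zS)

omit [Fintype κI] [Fintype κO] [DecidableEq κI] [DecidableEq κO] in
/-- The scaled `U_st` in block form: inner–inner `ε U^S_st`, inner–outer `ε X`, outer–outer `U^{G/S}_st + ε (…)`. [cite: AoyamaEtAl2006, §3.3] -/
theorem UMat_adapted (ε : R) :
    UMat (adaptedT TI TOS TOO) (scaledZ zS zO ε) =
      fromBlocks (ε • UMat TI zS) (ε • crossMat TI TOS zS) (ε • (crossMat TI TOS zS)ᵀ) (UMat TOO zO + ε • UMat TOS zS) := by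
  ext (s | s) (t | t)
  · simp only [UMat, adaptedT, scaledZ, fromBlocks_apply₁₁, fromBlocks_apply₁₂, Fintype.sum_sum_type, Sum.elim_inl, Sum.elim_inr,
      Matrix.zero_apply, Int.cast_zero, zero_mul, Finset.sum_const_zero, add_zero, Matrix.smul_apply, smul_eq_mul, Finset.mul_sum]
    exact Finset.sum_congr rfl fun b _ => by ring
  · simp only [UMat, adaptedT, scaledZ, crossMat, fromBlocks_apply₁₁, fromBlocks_apply₁₂, fromBlocks_apply₂₁, fromBlocks_apply₂₂,
      Fintype.sum_sum_type, Sum.elim_inl, Sum.elim_inr, Matrix.zero_apply, Int.cast_zero, zero_mul, Finset.sum_const_zero, add_zero,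
      Matrix.smul_apply, smul_eq_mul, Finset.mul_sum]
    exact Finset.sum_congr rfl fun b _ => by ring
  · simp only [UMat, adaptedT, scaledZ, crossMat, fromBlocks_apply₁₁, fromBlocks_apply₁₂, fromBlocks_apply₂₁, fromBlocks_apply₂₂,
      Fintype.sum_sum_type, Sum.elim_inl, Sum.elim_inr, Matrix.zero_apply, Int.cast_zero, mul_zero, zero_mul, Finset.sum_const_zero,
      add_zero, Matrix.smul_apply, smul_eq_mul, Matrix.transpose_apply, Finset.mul_sum]
    exact Finset.sum_congr rfl fun b _ => by ring
  · simp only [UMat, adaptedT, scaledZ, fromBlocks_apply₂₁, fromBlocks_apply₂₂, Fintype.sum_sum_type, Sum.elim_inl, Sum.elim_inr,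
      Matrix.add_apply, Matrix.smul_apply, smul_eq_mul, Finset.mul_sum]
    rw [add_comm]
    exact congrArg₂ (· + ·) rfl (Finset.sum_congr rfl fun b _ => by ring)

/-- Factorisation `U_st(ε) = diag(ε·1_{κI}, 1_{κO}) · M(ε)`. [cite: AoyamaEtAl2006, §3.3] -/
theorem UMat_adapted_eq_mul (ε : R) :
    UMat (adaptedT TI TOS TOO) (scaledZ zS zO ε) =
      fromBlocks (ε • (1 : Matrix κI κI R)) 0 0 (1 : Matrix κO κO R) * cofMat TI TOS TOO zS zO ε := by
  rw [UMat_adapted, cofMat, fromBlocks_multiply]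
  simp only [Matrix.zero_mul, add_zero, zero_add, Matrix.one_mul, Matrix.smul_mul]

/-- `det diag(ε·1_{κI}, 1_{κO}) = ε^{n_S}`. [folklore] -/
private theorem det_scaleBlock (ε : R) :
    (fromBlocks (ε • (1 : Matrix κI κI R)) 0 0 (1 : Matrix κO κO R)).det = ε ^ Fintype.card κI := by
  rw [det_fromBlocks_zero₂₁, det_one, mul_one, det_smul, det_one, mul_one]

/-- **«U = O(ε^{n_S})», exactly**: `U(ε) = ε^{n_S} · det M(ε)`, `n_S` = the number of inner circuits. [cite: AoyamaEtAl2006, §3.1 and §3.3] -/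
theorem UDet_adapted (ε : R) :
    UDet (adaptedT TI TOS TOO) (scaledZ zS zO ε) = ε ^ Fintype.card κI * (cofMat TI TOS TOO zS zO ε).det := by
  rw [UDet, UMat_adapted_eq_mul, det_mul, det_scaleBlock]

/-- **«[U]^S_UV = U_S U_{G/S}»**: the leading coefficient `det M(0) = U^S · U^{G/S}` (in the dictionary: `UDet TI zS = U_S`, `UDet TOO zO = U_{G/S}`).
[cite: AoyamaEtAl2006, §3.3 (eq. [U]^S_UV = U_S U_{G/S})] -/
theorem det_cofMat_zero : (cofMat TI TOS TOO zS zO 0).det = UDet TI zS * UDet TOO zO := by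
  simp only [cofMat, zero_smul, add_zero]
  rw [det_fromBlocks_zero₂₁]
  rfl

/-- The diagonal of the scaling matrix `diag(ε·1_{κI}, 1_{κO})`. [folklore] -/
private def scaleDiag (ε : R) : κI ⊕ κO → R := Sum.elim (fun _ => ε) (fun _ => 1)

omit [Fintype κI] [Fintype κO] in
/-- The scaling matrix is `diagonal (scaleDiag ε)`. [folklore] -/
private theorem scaleBlock_eq_diagonal (ε : R) :
    fromBlocks (ε • (1 : Matrix κI κI R)) 0 0 (1 : Matrix κO κO R) = diagonal (scaleDiag ε) := by
  ext (i | i) (j | j)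
  · by_cases hij : i = j
    · subst hij; simp [scaleDiag]
    · simp [scaleDiag, hij]
  · simp [scaleDiag]
  · simp [scaleDiag]
  · by_cases hij : i = j
    · subst hij; simp [scaleDiag]
    · simp [scaleDiag, hij]

/-- `∏_{j ≠ inl i} scaleDiag ε j = ε^{n_S − 1}`. [folklore] -/
private theorem prod_erase_inl_scaleDiag (ε : R) (i : κI) :
    ∏ j ∈ (univ : Finset (κI ⊕ κO)).erase (Sum.inl i), scaleDiag ε j = ε ^ (Fintype.card κI - 1) := by
  have hu : Function.update (scaleDiag (κI := κI) (κO := κO) ε) (Sum.inl i) 1 (Sum.inl i) = 1 := Function.update_self _ _ _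
  have h1 : ∏ j ∈ (univ : Finset (κI ⊕ κO)).erase (Sum.inl i), scaleDiag ε j =
      ∏ j ∈ (univ : Finset (κI ⊕ κO)).erase (Sum.inl i), Function.update (scaleDiag ε) (Sum.inl i) 1 j :=
    Finset.prod_congr rfl fun j hj => by rw [Function.update_of_ne (Finset.ne_of_mem_erase hj)]
  rw [h1, Finset.prod_erase _ hu, Fintype.prod_sum_type]
  have h2 : ∀ b : κO, Function.update (scaleDiag (κI := κI) (κO := κO) ε) (Sum.inl i) 1 (Sum.inr b) = 1 := fun b => by
    rw [Function.update_of_ne Sum.inr_ne_inl]; rfl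
  have h3 : ∀ a ∈ (univ : Finset κI).erase i, Function.update (scaleDiag (κI := κI) (κO := κO) ε) (Sum.inl i) 1 (Sum.inl a) = ε :=
    fun a ha => by rw [Function.update_of_ne (fun h => Finset.ne_of_mem_erase ha (Sum.inl_injective h))]; rfl
  simp only [h2, Finset.prod_const_one, mul_one]
  rw [← Finset.prod_erase (univ : Finset κI) hu, Finset.prod_congr rfl h3, Finset.prod_const, Finset.card_erase_of_mem (mem_univ i),
    Finset.card_univ]

/-- `∏_{j ≠ inr i} scaleDiag ε j = ε^{n_S}`. [folklore] -/
private theorem prod_erase_inr_scaleDiag (ε : R) (i : κO) :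
    ∏ j ∈ (univ : Finset (κI ⊕ κO)).erase (Sum.inr i), scaleDiag ε j = ε ^ Fintype.card κI := by
  have hu : scaleDiag (κI := κI) (κO := κO) ε (Sum.inr i) = 1 := rfl
  rw [Finset.prod_erase _ hu, Fintype.prod_sum_type]
  simp [scaleDiag, Finset.prod_const, Finset.card_univ]

/-- `adj diag(ε·1_{κI}, 1_{κO}) = diag(ε^{n_S−1}·1_{κI}, ε^{n_S}·1_{κO})`. [folklore] -/
private theorem adjugate_scaleBlock (ε : R) :
    (fromBlocks (ε • (1 : Matrix κI κI R)) 0 0 (1 : Matrix κO κO R)).adjugate =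
      fromBlocks (ε ^ (Fintype.card κI - 1) • (1 : Matrix κI κI R)) 0 0 (ε ^ Fintype.card κI • (1 : Matrix κO κO R)) := by
  rw [scaleBlock_eq_diagonal, adjugate_diagonal]
  ext (i | i) (j | j)
  · by_cases hij : i = j
    · subst hij; simp [prod_erase_inl_scaleDiag]
    · simp [hij]
  · simp
  · simp
  · by_cases hij : i = j
    · subst hij; simp [prod_erase_inr_scaleDiag]
    · simp [hij]

/-- The adjugate of the scaled `U_st`: `adj U_st(ε) = adj M(ε) · diag(ε^{n_S−1}·1, ε^{n_S}·1)`. [cite: AoyamaEtAl2006, §3.3] -/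
theorem adjugate_UMat_adapted (ε : R) :
    (UMat (adaptedT TI TOS TOO) (scaledZ zS zO ε)).adjugate =
      (cofMat TI TOS TOO zS zO ε).adjugate *
        fromBlocks (ε ^ (Fintype.card κI - 1) • (1 : Matrix κI κI R)) 0 0 (ε ^ Fintype.card κI • (1 : Matrix κO κO R)) := by
  rw [UMat_adapted_eq_mul, adjugate_mul_distrib, adjugate_scaleBlock]

omit [Fintype κI] [Fintype κO] [Fintype μS] [Fintype μO] [DecidableEq κI] [DecidableEq κO] in
/-- The adapted loop matrix with entries cast to `R`, in block form. [cite: AoyamaEtAl2006, §3.3] -/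
theorem adaptedT_map :
    (adaptedT TI TOS TOO).map (Int.cast : ℤ → R) =
      fromBlocks (TI.map (Int.cast : ℤ → R)) 0 (TOS.map (Int.cast : ℤ → R)) (TOO.map (Int.cast : ℤ → R)) := by
  rw [adaptedT, fromBlocks_map, Matrix.map_zero _ Int.cast_zero]

/-- The left factor `Tᵀ · adj M(ε)` common to all `B` entries. [cite: AoyamaEtAl2006, §3.3] -/
def leftB (ε : R) : Matrix (μS ⊕ μO) (κI ⊕ κO) R :=
  ((adaptedT TI TOS TOO).map (Int.cast : ℤ → R))ᵀ * (cofMat TI TOS TOO zS zO ε).adjugate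

/-- Cofactor of `B_{a j}`, `j ∉ S`: `Σ_{t outer} (Tᵀ adj M(ε))_{a,t} ξ_{j,t}`. [cite: AoyamaEtAl2006, §3.3] -/
def cofBO (ε : R) (a : μS ⊕ μO) (b : μO) : R := ∑ t : κO, leftB TI TOS TOO zS zO ε a (Sum.inr t) * (TOO t b : R)

/-- Cofactor of `B_{a j}`, `j ∈ S`: `Σ_{t inner} (Tᵀ adj M(ε))_{a,t} ξ_{j,t} + ε Σ_{t outer} (Tᵀ adj M(ε))_{a,t} ξ_{j,t}`. [cite: AoyamaEtAl2006, §3.3] -/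
def cofBS (ε : R) (a : μS ⊕ μO) (b : μS) : R :=
  ∑ t : κI, leftB TI TOS TOO zS zO ε a (Sum.inl t) * (TI t b : R) + ε * ∑ t : κO, leftB TI TOS TOO zS zO ε a (Sum.inr t) * (TOS t b : R)

/-- `B` through the factorisation: `B_{ab}(ε) = (Tᵀ adj M(ε) · diag(ε^{n_S−1}, ε^{n_S}) · T)_{ab}`. [cite: AoyamaEtAl2006, §3.3] -/
theorem BAdj_adapted_eq (ε : R) (a b : μS ⊕ μO) :
    BAdj (adaptedT TI TOS TOO) (scaledZ zS zO ε) a b =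
      (leftB TI TOS TOO zS zO ε *
        fromBlocks (ε ^ (Fintype.card κI - 1) • TI.map (Int.cast : ℤ → R)) 0
          (ε ^ Fintype.card κI • TOS.map (Int.cast : ℤ → R)) (ε ^ Fintype.card κI • TOO.map (Int.cast : ℤ → R))) a b := by
  have hQT : fromBlocks (ε ^ (Fintype.card κI - 1) • (1 : Matrix κI κI R)) 0 0 (ε ^ Fintype.card κI • (1 : Matrix κO κO R)) *
      (adaptedT TI TOS TOO).map (Int.cast : ℤ → R) =
      fromBlocks (ε ^ (Fintype.card κI - 1) • TI.map (Int.cast : ℤ → R)) 0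
        (ε ^ Fintype.card κI • TOS.map (Int.cast : ℤ → R)) (ε ^ Fintype.card κI • TOO.map (Int.cast : ℤ → R)) := by
    rw [adaptedT_map, fromBlocks_multiply]
    simp only [Matrix.smul_mul, Matrix.one_mul, Matrix.zero_mul, add_zero, zero_add, Matrix.mul_zero]
  rw [BAdj_eq_mul_apply, adjugate_UMat_adapted, ← Matrix.mul_assoc, Matrix.mul_assoc _ _ ((adaptedT TI TOS TOO).map _), hQT, leftB]

/-- **«B_ij = O(ε^{n_S}) otherwise»**: for a line `j ∉ S` and any line `a`, `B_{a j}(ε) = ε^{n_S} · cofBO(ε)`. [cite: AoyamaEtAl2006, §3.1 (eq. for B_ij)] -/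
theorem BAdj_adapted_inr (ε : R) (a : μS ⊕ μO) (b : μO) :
    BAdj (adaptedT TI TOS TOO) (scaledZ zS zO ε) a (Sum.inr b) = ε ^ Fintype.card κI * cofBO TI TOS TOO zS zO ε a b := by
  rw [BAdj_adapted_eq, Matrix.mul_apply, Fintype.sum_sum_type, cofBO, Finset.mul_sum]
  simp only [fromBlocks_apply₁₂, Matrix.zero_apply, mul_zero, Finset.sum_const_zero, zero_add, fromBlocks_apply₂₂, Matrix.smul_apply,
    Matrix.map_apply, smul_eq_mul]
  exact Finset.sum_congr rfl fun t _ => by ring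

/-- **«B_ij = O(ε^{n_S−1}) if i, j ∈ S»** (the order; for `n_S ≥ 1`): for `j ∈ S` and any `a`, `B_{a j}(ε) = ε^{n_S−1} · cofBS(ε)`.
[cite: AoyamaEtAl2006, §3.1 (eq. for B_ij)] -/
theorem BAdj_adapted_inl (hI : 0 < Fintype.card κI) (ε : R) (a : μS ⊕ μO) (b : μS) :
    BAdj (adaptedT TI TOS TOO) (scaledZ zS zO ε) a (Sum.inl b) = ε ^ (Fintype.card κI - 1) * cofBS TI TOS TOO zS zO ε a b := by
  have hpow : ε ^ Fintype.card κI = ε ^ (Fintype.card κI - 1) * ε := by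
    rw [← pow_succ, Nat.sub_add_cancel hI]
  rw [BAdj_adapted_eq, Matrix.mul_apply, Fintype.sum_sum_type, cofBS, mul_add, Finset.mul_sum, ← mul_assoc, Finset.mul_sum]
  simp only [fromBlocks_apply₁₁, fromBlocks_apply₂₁, Matrix.smul_apply, Matrix.map_apply, smul_eq_mul, hpow]
  exact congrArg₂ (· + ·) (Finset.sum_congr rfl fun t _ => by ring) (Finset.sum_congr rfl fun t _ => by ring)

omit [Fintype κI] [Fintype κO] [Fintype μS] [Fintype μO] [DecidableEq κI] [DecidableEq κO] in
/-- Inner circuit, line of `S`: entry `ξ` of `TI`. [cite: AoyamaEtAl2006, §3.3] -/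
private theorem adaptedT_map_inl_inl (s : κI) (a : μS) :
    (adaptedT TI TOS TOO).map (Int.cast : ℤ → R) (Sum.inl s) (Sum.inl a) = (TI s a : R) := by simp [adaptedT]

omit [Fintype κI] [Fintype κO] [Fintype μS] [Fintype μO] [DecidableEq κI] [DecidableEq κO] in
/-- Inner circuit, outer line: `0` (adaptedness). [cite: AoyamaEtAl2006, §3.3] -/
private theorem adaptedT_map_inl_inr (s : κI) (a : μO) :
    (adaptedT TI TOS TOO).map (Int.cast : ℤ → R) (Sum.inl s) (Sum.inr a) = 0 := by simp [adaptedT]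

omit [Fintype κI] [Fintype κO] [Fintype μS] [Fintype μO] [DecidableEq κI] [DecidableEq κO] in
/-- Outer circuit, line of `S`: entry of `TOS`. [cite: AoyamaEtAl2006, §3.3] -/
private theorem adaptedT_map_inr_inl (s : κO) (a : μS) :
    (adaptedT TI TOS TOO).map (Int.cast : ℤ → R) (Sum.inr s) (Sum.inl a) = (TOS s a : R) := by simp [adaptedT]

omit [Fintype κI] [Fintype κO] [Fintype μS] [Fintype μO] [DecidableEq κI] [DecidableEq κO] in
/-- Outer circuit, outer line: entry of `TOO`. [cite: AoyamaEtAl2006, §3.3] -/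
private theorem adaptedT_map_inr_inr (s : κO) (a : μO) :
    (adaptedT TI TOS TOO).map (Int.cast : ℤ → R) (Sum.inr s) (Sum.inr a) = (TOO s a : R) := by simp [adaptedT]

omit [Fintype κI] [Fintype κO] [DecidableEq κI] [DecidableEq κO] in
/-- `M(0)` is block upper-triangular: `[[U^S, X], [0, U^{G/S}]]`. [cite: AoyamaEtAl2006, §3.3] -/
theorem cofMat_zero : cofMat TI TOS TOO zS zO 0 = fromBlocks (UMat TI zS) (crossMat TI TOS zS) 0 (UMat TOO zO) := by
  simp only [cofMat, zero_smul, add_zero]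

/-- **«[B_ij]^S_UV = B^{G/S}_ij U_S, i, j ∈ (G/S)»**: the leading coefficient of `B_{ij}(ε) = ε^{n_S} cofBO(ε)` for two outer lines is
`U^S · B^{G/S}_{ij}`. [cite: AoyamaEtAl2006, §3.3] -/
theorem cofBO_zero (a b : μO) : cofBO TI TOS TOO zS zO 0 (Sum.inr a) b = UDet TI zS * BAdj TOO zO a b := by
  have hL : ∀ t : κO, leftB TI TOS TOO zS zO 0 (Sum.inr a) (Sum.inr t) =
      ∑ s : κO, (TOO s a : R) * ((UMat TI zS).det * (UMat TOO zO).adjugate s t) := by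
    intro t
    rw [leftB, cofMat_zero, Matrix.mul_apply, Fintype.sum_sum_type]
    simp only [Matrix.transpose_apply, adaptedT_map_inl_inr, zero_mul, Finset.sum_const_zero, zero_add, adaptedT_map_inr_inr,
      adjugate_fromBlocks_zero₂₁_inr_inr]
  simp only [cofBO, hL, BAdj, UDet, Finset.sum_mul, Finset.mul_sum]
  rw [Finset.sum_comm]
  exact Finset.sum_congr rfl fun s _ => Finset.sum_congr rfl fun t _ => by ring

/-- **«[B_ij]^S_UV = B^S_ij U_{G/S}» (i, j ∈ S)**: the leading coefficient of `B_{ij}(ε) = ε^{n_S−1} cofBS(ε)` for two lines of `S` is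
`U^{G/S} · B^S_{ij}`. [cite: AoyamaEtAl2006, §3.3] -/
theorem cofBS_zero (a b : μS) : cofBS TI TOS TOO zS zO 0 (Sum.inl a) b = UDet TOO zO * BAdj TI zS a b := by
  have hL : ∀ t : κI, leftB TI TOS TOO zS zO 0 (Sum.inl a) (Sum.inl t) =
      ∑ s : κI, (TI s a : R) * ((UMat TOO zO).det * (UMat TI zS).adjugate s t) := by
    intro t
    rw [leftB, cofMat_zero, Matrix.mul_apply, Fintype.sum_sum_type]
    simp only [Matrix.transpose_apply, adaptedT_map_inl_inl, adaptedT_map_inr_inl, adjugate_fromBlocks_zero₂₁_inl_inl,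
      adjugate_fromBlocks_zero₂₁_inr_inl, mul_zero, Finset.sum_const_zero, add_zero]
  simp only [cofBS, hL, zero_mul, Finset.sum_const_zero, add_zero, BAdj, UDet, Finset.sum_mul, Finset.mul_sum]
  rw [Finset.sum_comm]
  exact Finset.sum_congr rfl fun s _ => Finset.sum_congr rfl fun t _ => by ring

end Adapted

end Literature.MathematicalPhysics.QuantumFieldTheory.AoyamaEtAl2006
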